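import Summits.QuantumFields.BalabanUV.Beta.FP.KernelStepDressingPeriodised

/-!
# `BalabanUV.Beta.FP.KernelStepDressingRecentre` — road «FP», binder row D1, ROUTE T (β1), (H5-F box) junctions, THE ROAD's ANALYTIC PIECE (i), SECOND ORDER — ENGINE:
# **`perZ ∘ dper` PASSES THROUGH ANY COMMON-PAIR SUPERPOSITION; ONE-LEG RE-CENTRING OF A TWO-CENTRE BOUND UNDER A COLUMN WEIGHT**

WHY (located).  The second-order twin of `KernelStepDressingPeriodised` (p743874 ✓) — `perF M (dper M (dressW N L w W μ y ν y′))` as the double superposition of the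
`perF M (dper M (W c t e t′))` — is what the END's second-order F-junctions `hHF₂ hQF₂` read (road g59 HANDOFF item (3); SPEC-64 §19 (3); an2 g81 W-4: (C1) class).  The members
`W c t e t′` live at TWO points `(N•t, N•t′)`, so the two superpositions are NESTED (the pair index does not fit `KernelWard.ProdBound`): the inner sum over `t′` is re-centred
at `N•(L•y′)` in its SECOND leg, the outer sum over `t` at `N•(L•y)` in its FIRST leg, and each time p743874's §0 two-centre engine `dper_tsum_family₂` applies at a COMMON
pair.  This file types the two generic pieces that engine lacks: §0 the SECOND (torus) periodisation through a common-pair superposition (`decays_dper` at two centres — the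
fixed factor `e^{(δ′∕2)|p − q|₁}` rides in the member constant — and `KernelWard.tsum_comm_of_prodBound`), §1 the one-leg re-centring bounds (rate `min δ (δw∕(4N))`, the
column weight's spare half pays for the move, exactly p743874's `abs_dressVTerm_le` budget with one leg fixed).  The dressed family itself is the next file
(`KernelStepDressingPeriodisedW`).

WHAT ([folklore] lattice-sum bookkeeping; generic dimension `d`; no `def`, no `def … : Prop`, nothing cited, 0 sorry).
* §0 `dper_const_mul`, `perZ_const_mul`; `prodBound_perZ_dper_family₂`; **`perZ_dper_tsum_family₂`** (`perZ M (dper M (x z ↦ Σ'_n T n x z)) = Σ'_n perZ M (dper M (T n))` for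
  `|T n x z a b| ≤ g n · e^{−δ′(|x−p|₁+|z−q|₁)}`, `Σ g < ∞`); `summable_translate_dper_tsum_family₂`.
* §1 **`abs_recentre_fst_le`** (`BiLoc T (N•t) q` × `w c μ (L•y − t)` ⇒ bi-localised at `(N•(L•y), q)` with constant `Cw·C·e^{−(δw∕2)|t − L•y|₁}`), **`abs_recentre_snd_le`** (mirror);
  the summable constants are p743874's `summable_dressVWeight`.
WHAT THIS IS NOT: not the dressed family (next file); not a junction; nothing of Bałaban's asserted, valued or discharged; 0 estimates beyond [folklore] geometric series BY NAME;
0∕4 row-D1 binders; NOT (C1), NOT (T-ID), NOT D1, NEVER «G-an2-4 closed», NOT BetaPertH, NOT continuum, NOT Clay.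
HONEST DEPENDENCY (page 1, mandatory): continuum YM on T⁴ ⇐ BetaPertH ∧ nine spine estimates (0/9 proved); BetaPertH ⇐ (D1) ∧ (D4) ∧ CAP+tail;
G-an2-4 gates asym, D1 and NE2/3/4.  HONEST FRAMING (cell contract, verbatim): «discharging `BetaPertH` makes Bałaban's UV stability UNCONDITIONAL —
a real constructive-QFT result; it is NOT the continuum limit and NOT the Clay problem.»  ABSOLUTE RULE (cell charter, verbatim): «No internally-minted
statement may enter as a cited fact. Every hypothesis is either kernel-proved in this package or a verbatim quotation of a PUBLISHED theorem with page
reference. The manuscript(s) under audit are NOT citable for their own disputed steps — they are the thing under adjudication; programme-internal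
(2001/route/tribunal) claims are never citable.»  Road «FP» OWNER, b2b-balaban-beta-d1-p3 gen 60, 2026-08-29.  No existing file touched.
-/

noncomputable section

open scoped BigOperators

namespace Summit.QuantumFields.BalabanUV.Beta.FP.KernelStepDressingRecentre

open Finset
open Literature.MathematicalPhysics.QuantumFieldTheory
open Literature.MathematicalPhysics.QuantumFieldTheory.Balaban1983to89
open Literature.MathematicalPhysics.QuantumFieldTheory.Balaban1983to89.Beta
open B12Sec2to5 (l1 l1_nonneg)
open B4TorusKernel.MultiPeriod (translate)
open B4Sect5Proof (latticeConst latticeConst_nonneg)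
open ExpKernelCalculus (Site MKer BiLoc Decays VertexFamily₂ l1_natSmul l1_sub_triangle summable_exp_shift' l1_sub_symm)
open DressedMomentNormalisation (EKer)
open OneStepResolventKernel (Fib)
open InterLevelTransport (cwsum cwsum_apply)
open KernelWard (ProdBound tsum_comm_of_prodBound)
open Summit.QuantumFields.BalabanUV.Beta.FP.KernelPeriodisationFib (Idx perF perF_apply perZ perZ_apply)
open Summit.QuantumFields.BalabanUV.Beta.FP.KernelPeriodisationFibLoc (dper dper_apply summable_dper decays_dper summable_exp_l1_translate)
open Summit.QuantumFields.BalabanUV.Beta.FP.KernelStepDressing (dressW dressW_apply)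
open Summit.QuantumFields.BalabanUV.Beta.FP.KernelStepDressingHessKer (dressW_eq_sum abs_col_le)
open Summit.QuantumFields.BalabanUV.Beta.FP.KernelStepDressingPeriodised (biLoc_tsum_family₂ dper_tsum_family₂ summable_dressVWeight)

variable {d : ℕ}

/-! ## §0 A scalar leaves both periodisations; `perZ ∘ dper` passes through a common-pair superposition -/

section Engine

variable (M : Fin (d + 1) → ℕ) [∀ μ, NeZero (M μ)]

omit [∀ μ, NeZero (M μ)] in
/-- [folklore] a scalar leaves `dper`. -/
theorem dper_const_mul (ω : ℝ) (K : MKer (d + 1) (Fib d)) (x z : Site (d + 1)) (a b : Fib d) :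
    dper M (fun x z a b => ω * K x z a b) x z a b = ω * dper M K x z a b := by
  simp only [dper_apply, ← tsum_mul_left]

omit [∀ μ, NeZero (M μ)] in
/-- [folklore] a scalar leaves `perZ`. -/
theorem perZ_const_mul (ω : ℝ) (K : MKer (d + 1) (Fib d)) (x z : Site (d + 1)) (a b : Fib d) :
    perZ M (fun x z a b => ω * K x z a b) x z a b = ω * perZ M K x z a b := by
  simp only [perZ_apply, ← tsum_mul_left]

variable {T : Site (d + 1) → MKer (d + 1) (Fib d)} {p q : Site (d + 1)} {g : Site (d + 1) → ℝ} {δ' : ℝ}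

/-- [folklore] the (copy, member) double family behind `perZ M (dper M (Σ' n, T n))` has a product majorant when every member is bi-localised at a COMMON pair `(p, q)`
with summable constants: `decays_dper` (two centres; the fixed factor `e^{(δ′∕2)|p − q|₁}` rides in the member constant) × `summable_exp_l1_translate`. -/
theorem prodBound_perZ_dper_family₂ (hT : ∀ n x z a b, |T n x z a b| ≤ g n * Real.exp (-δ' * (l1 (x - p) + l1 (z - q)))) (hg : Summable g)
    (hg0 : ∀ n, 0 ≤ g n) (hδ' : 0 < δ') (x z : Site (d + 1)) (a b : Fib d) :
    ProdBound fun (mm : Site (d + 1)) (n : Site (d + 1)) => dper M (T n) x (translate M z mm) a b := by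
  refine ⟨fun mm => Real.exp (-(δ' / 2) * l1 (translate M z mm - x)),
    fun n => g n * Real.exp (δ' / 2 * l1 (p - q)) * latticeConst (d + 1) (δ' / 2),
    (summable_exp_l1_translate M (half_pos hδ') x z).1, (hg.mul_right _).mul_right _, fun mm => (Real.exp_pos _).le,
    fun n => mul_nonneg (mul_nonneg (hg0 n) (Real.exp_pos _).le) (latticeConst_nonneg _ (half_pos hδ').le), fun mm n => ?_⟩
  have hdec := decays_dper M (show BiLoc (T n) p q (g n) δ' from fun x z a b => hT n x z a b) (hg0 n) hδ' x (translate M z mm) a b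
  rw [l1_sub_symm x (translate M z mm)] at hdec
  calc |dper M (T n) x (translate M z mm) a b|
      ≤ g n * Real.exp (δ' / 2 * l1 (p - q)) * latticeConst (d + 1) (δ' / 2) * Real.exp (-(δ' / 2) * l1 (translate M z mm - x)) := hdec
    _ = Real.exp (-(δ' / 2) * l1 (translate M z mm - x)) * (g n * Real.exp (δ' / 2 * l1 (p - q)) * latticeConst (d + 1) (δ' / 2)) := by ring

/-- [folklore] **`perZ_dper_tsum_family₂` — THE SECOND PERIODISATION PASSES THROUGH A COMMON-PAIR SUPERPOSITION**:
`perZ M (dper M (x z ↦ Σ'_n T n x z)) x z a b = Σ'_n perZ M (dper M (T n)) x z a b`. -/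
theorem perZ_dper_tsum_family₂ (hT : ∀ n x z a b, |T n x z a b| ≤ g n * Real.exp (-δ' * (l1 (x - p) + l1 (z - q)))) (hg : Summable g)
    (hg0 : ∀ n, 0 ≤ g n) (hδ' : 0 < δ') (x z : Site (d + 1)) (a b : Fib d) :
    perZ M (dper M (fun x z a b => ∑' n, T n x z a b)) x z a b = ∑' n, perZ M (dper M (T n)) x z a b := by
  rw [perZ_apply]
  have step1 : (∑' mm : Site (d + 1), dper M (fun x z a b => ∑' n, T n x z a b) x (translate M z mm) a b)
      = ∑' mm : Site (d + 1), ∑' n, dper M (T n) x (translate M z mm) a b :=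
    tsum_congr fun mm => dper_tsum_family₂ M hT hg hg0 hδ' x _ a b
  rw [step1, tsum_comm_of_prodBound (prodBound_perZ_dper_family₂ M hT hg hg0 hδ' x z a b)]
  refine tsum_congr fun n => ?_
  rw [perZ_apply]

/-- [folklore] the copy family of `dper M (Σ' n, T n)` in the second argument is summable (for `perZ`): `decays_dper` at two centres. -/
theorem summable_translate_dper_tsum_family₂ (hT : ∀ n x z a b, |T n x z a b| ≤ g n * Real.exp (-δ' * (l1 (x - p) + l1 (z - q)))) (hg : Summable g)
    (hg0 : ∀ n, 0 ≤ g n) (hδ' : 0 < δ') (x z : Site (d + 1)) (a b : Fib d) :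
    Summable fun mm : Site (d + 1) => dper M (fun x z a b => ∑' n, T n x z a b) x (translate M z mm) a b := by
  obtain ⟨h0, h1, -⟩ := (prodBound_perZ_dper_family₂ M hT hg hg0 hδ' x z a b).summable
  have h := (h0.hasSum.prod_fiberwise fun mm => (h1 mm).hasSum).summable
  refine h.congr fun mm => ?_
  exact (dper_tsum_family₂ M hT hg hg0 hδ' x _ a b).symm

end Engine

/-! ## §1 One-leg re-centring of a two-centre bound under a column weight -/

section Recentre

variable {N : ℕ} [NeZero N] (L : ℕ) {w : EKer (d + 1)} {Cw δw : ℝ} {T : MKer (d + 1) (Fib d)} {C δ : ℝ}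

/-- [folklore] **`abs_recentre_fst_le`** — a column weight decaying from `0` at rate `δw`, read at `L•y − t`, times a kernel bi-localised at `(N•t, q)` (rate `δ`), is bounded by
`(Cw·C·e^{−(δw∕2)|t − L•y|₁}) · e^{−m(|x − N•(L•y)|₁ + |z − q|₁)}`, `m = min δ (δw∕(4N))`: the FIRST centre moves to `N•(L•y)`, the second stays. -/
theorem abs_recentre_fst_le (hw : ∀ c a u, |w c a u| ≤ Cw * Real.exp (-δw * l1 u)) (hCw : 0 ≤ Cw) (hδw : 0 < δw)
    {t q : Site (d + 1)} (hT : BiLoc T ((N : ℤ) • t) q C δ) (hC : 0 ≤ C) (hδ : 0 < δ) (c μ : Fin (d + 1)) (y x z : Site (d + 1)) (a b : Fib d) :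
    |w c μ ((L : ℤ) • y - t) * T x z a b|
      ≤ (Cw * C * Real.exp (-(δw / 2) * l1 (t - (L : ℤ) • y)))
          * Real.exp (-(min δ (δw / (4 * N))) * (l1 (x - (N : ℤ) • ((L : ℤ) • y)) + l1 (z - q))) := by
  have hNpos : (0 : ℝ) < N := by exact_mod_cast Nat.pos_of_ne_zero (NeZero.ne N)
  have h1 : |w c μ ((L : ℤ) • y - t)| ≤ Cw * Real.exp (-δw * l1 (t - (L : ℤ) • y)) := abs_col_le hw c μ _ t
  have h2 : |T x z a b| ≤ C * Real.exp (-δ * (l1 (x - (N : ℤ) • t) + l1 (z - q))) := hT x z a b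
  set A := l1 (t - (L : ℤ) • y) with hA
  set B := l1 (x - (N : ℤ) • t) with hB
  set C' := l1 (z - q) with hC'
  set B' := l1 (x - (N : ℤ) • ((L : ℤ) • y)) with hB'
  set m := min δ (δw / (4 * N)) with hm
  have hNA : l1 ((N : ℤ) • t - (N : ℤ) • ((L : ℤ) • y)) = N * A := by rw [← smul_sub, l1_natSmul]
  have hB'le : B' ≤ B + N * A := by
    have h := l1_sub_triangle x ((N : ℤ) • t) ((N : ℤ) • ((L : ℤ) • y)); rwa [hNA] at h
  have hA0 : 0 ≤ A := l1_nonneg _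
  have hB0 : 0 ≤ B := l1_nonneg _
  have hC0 : 0 ≤ C' := l1_nonneg _
  have hm0 : 0 ≤ m := le_min hδ.le (by positivity)
  have hmδ : m ≤ δ := min_le_left _ _
  have hmN : m * N ≤ δw / 4 := by
    have h := min_le_right δ (δw / (4 * N))
    rw [← hm] at h
    have := mul_le_mul_of_nonneg_right h hNpos.le
    calc m * N ≤ δw / (4 * N) * N := this
      _ = δw / 4 := by field_simp
  have key : -δw * A + -δ * (B + C') ≤ -(δw / 2) * A + -m * (B' + C') := by
    have hmB : m * B' ≤ m * B + (m * N) * A := by nlinarith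
    nlinarith
  calc |w c μ ((L : ℤ) • y - t) * T x z a b| = |w c μ ((L : ℤ) • y - t)| * |T x z a b| := abs_mul _ _
    _ ≤ (Cw * Real.exp (-δw * A)) * (C * Real.exp (-δ * (B + C'))) := mul_le_mul h1 h2 (abs_nonneg _) ((abs_nonneg _).trans h1)
    _ = Cw * C * Real.exp (-δw * A + -δ * (B + C')) := by rw [Real.exp_add]; ring
    _ ≤ Cw * C * Real.exp (-(δw / 2) * A + -m * (B' + C')) := mul_le_mul_of_nonneg_left (Real.exp_le_exp.2 key) (mul_nonneg hCw hC)
    _ = (Cw * C * Real.exp (-(δw / 2) * A)) * Real.exp (-m * (B' + C')) := by rw [Real.exp_add]; ring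

/-- [folklore] **`abs_recentre_snd_le`** — the mirror statement: a kernel bi-localised at `(p, N•t′)` times a column weight read at `L•y′ − t′` is bounded by
`(Cw·C·e^{−(δw∕2)|t′ − L•y′|₁}) · e^{−m(|x − p|₁ + |z − N•(L•y′)|₁)}`: the SECOND centre moves to `N•(L•y′)`, the first stays. -/
theorem abs_recentre_snd_le (hw : ∀ c a u, |w c a u| ≤ Cw * Real.exp (-δw * l1 u)) (hCw : 0 ≤ Cw) (hδw : 0 < δw)
    {p t' : Site (d + 1)} (hT : BiLoc T p ((N : ℤ) • t') C δ) (hC : 0 ≤ C) (hδ : 0 < δ) (e ν : Fin (d + 1)) (y' x z : Site (d + 1)) (a b : Fib d) :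
    |w e ν ((L : ℤ) • y' - t') * T x z a b|
      ≤ (Cw * C * Real.exp (-(δw / 2) * l1 (t' - (L : ℤ) • y')))
          * Real.exp (-(min δ (δw / (4 * N))) * (l1 (x - p) + l1 (z - (N : ℤ) • ((L : ℤ) • y')))) := by
  have hNpos : (0 : ℝ) < N := by exact_mod_cast Nat.pos_of_ne_zero (NeZero.ne N)
  have h1 : |w e ν ((L : ℤ) • y' - t')| ≤ Cw * Real.exp (-δw * l1 (t' - (L : ℤ) • y')) := abs_col_le hw e ν _ t'
  have h2 : |T x z a b| ≤ C * Real.exp (-δ * (l1 (x - p) + l1 (z - (N : ℤ) • t'))) := hT x z a b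
  set A := l1 (t' - (L : ℤ) • y') with hA
  set B := l1 (x - p) with hB
  set C' := l1 (z - (N : ℤ) • t') with hC'
  set C'' := l1 (z - (N : ℤ) • ((L : ℤ) • y')) with hC''
  set m := min δ (δw / (4 * N)) with hm
  have hNA : l1 ((N : ℤ) • t' - (N : ℤ) • ((L : ℤ) • y')) = N * A := by rw [← smul_sub, l1_natSmul]
  have hC''le : C'' ≤ C' + N * A := by
    have h := l1_sub_triangle z ((N : ℤ) • t') ((N : ℤ) • ((L : ℤ) • y')); rwa [hNA] at h
  have hA0 : 0 ≤ A := l1_nonneg _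
  have hB0 : 0 ≤ B := l1_nonneg _
  have hC0 : 0 ≤ C' := l1_nonneg _
  have hm0 : 0 ≤ m := le_min hδ.le (by positivity)
  have hmδ : m ≤ δ := min_le_left _ _
  have hmN : m * N ≤ δw / 4 := by
    have h := min_le_right δ (δw / (4 * N))
    rw [← hm] at h
    have := mul_le_mul_of_nonneg_right h hNpos.le
    calc m * N ≤ δw / (4 * N) * N := this
      _ = δw / 4 := by field_simp
  have key : -δw * A + -δ * (B + C') ≤ -(δw / 2) * A + -m * (B + C'') := by
    have hmC : m * C'' ≤ m * C' + (m * N) * A := by nlinarith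
    nlinarith
  calc |w e ν ((L : ℤ) • y' - t') * T x z a b| = |w e ν ((L : ℤ) • y' - t')| * |T x z a b| := abs_mul _ _
    _ ≤ (Cw * Real.exp (-δw * A)) * (C * Real.exp (-δ * (B + C'))) := mul_le_mul h1 h2 (abs_nonneg _) ((abs_nonneg _).trans h1)
    _ = Cw * C * Real.exp (-δw * A + -δ * (B + C')) := by rw [Real.exp_add]; ring
    _ ≤ Cw * C * Real.exp (-(δw / 2) * A + -m * (B + C'')) := mul_le_mul_of_nonneg_left (Real.exp_le_exp.2 key) (mul_nonneg hCw hC)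
    _ = (Cw * C * Real.exp (-(δw / 2) * A)) * Real.exp (-m * (B + C'')) := by rw [Real.exp_add]; ring

end Recentre

end Summit.QuantumFields.BalabanUV.Beta.FP.KernelStepDressingRecentre

end
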